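import Literature.NumberTheory.Automorphic.CuspFormCornerDecay
import Literature.NumberTheory.Automorphic.JPSSProjectedGlobalIntegral

/-!
# First-chamber decay of an `A_G`-invariant rapidly decreasing `Φ` at unipotent translates of the
corner `GL_m ↪ GL_n`

Summit `Langlands`, sub-problem `Langlands`, helper file under `Theorems/` supporting the crux
`PairLBoundaryJS` (stmt-Langlands-13622), line `Sketch`, wave 4 (decay road), registered stub
`stub_decay_regimeA` (E5a). For an `A_G`-invariant rapidly decreasing function `Φ` on `GL_n(𝔸_K)`
(Getz–Hahn (2024), Def. 9.3), `0 < m < n`, a compact set `𝒞` of upper unitriangular matrices of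
`GL_n(𝔸_K)`, a compact `Ωm ⊆ GL_m(𝔸_K)`, `0 < t ≤ 1` and `B > 0`, there is `C ≥ 0` with
`‖Φ(u · ι(z(τ) diag(b) y))‖ ≤ C (τ b_m)^{-B}` for all `u ∈ 𝒞`, `y ∈ Ωm`, `τ > 0` and all `b` in the
cone `bᵢ/bᵢ₊₁ ≥ t` of `GL_m` with `τ b_m ≥ 1` (`ι = glCorner : h ↦ diag(h, 1_{n-m})`, `b_m` the last
entry). This is the first conjunct of `exists_bound_corner_chambers` (`CuspFormCornerDecay`, the
mechanism behind "since the cusp forms are rapidly decreasing", Cogdell (2004), §2.2, PDF p. 182,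
in the direction `|det h| → ∞`) with an extra compact unipotent factor `u` on the left, absorbed
by the conjugation lemma of reduction theory (Getz–Hahn (2024), Lemma 9.5.1; Garrett (2018),
Claim 7.3.6: `a⁻¹ 𝒞 a` lies in a fixed compact set for `a` in the Siegel cone `A_{T₀}(t)`):
`ι(z(τ) diag(b)) = diag(c)`, `cᵢ = τ bᵢ (i < m)`, `cᵢ = 1 (i ≥ m)`, is `z(λ) diag(c')` with
`diag(c') ∈ A_{T₀}(t)` (same simple roots; the `m`-th one is `τ b_m ≥ 1 ≥ t`), and
`u diag(c) ι(y) = z(λ) diag(c') (diag(c')⁻¹ u diag(c')) ι(y)`.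

* `exists_posRealScalar_mul_posRealDiagonal_eq` — the normalisation `diag(a) = z(λ) diag(a')`,
  `∏ a'ᵢ = 1`, same simple roots (the argument of
  `IsRapidlyDecreasingGL.exists_bound_root_of_center'`).
* `decay_regimeA` — the estimate, hypotheses as section variables.
* `stub_decay_regimeA` — the registered closed form.

## References

* J. W. Cogdell, *Analytic theory of L-functions for GL_n*, in *An Introduction to the Langlands
  Program*, Birkhäuser (2004), §2.2, Thm. 2.1 [CogdellAnalyticTheory2004].
* J. R. Getz, H. Hahn, *An Introduction to Automorphic Representations*, GTM 300 (2024), Def. 9.3,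
  Lemma 9.5.1 [GetzHahn2024].
* P. Garrett, *Modern analysis of automorphic forms by example* (2018), Claim 7.3.6 [Garrett2018].
-/

noncomputable section

-- `Summit.Langlands.Langlands.…` (summit = sub-problem name, D-0017 layout) trips `dupNamespace`
set_option linter.dupNamespace false

open scoped MatrixGroups Topology Pointwise ENNReal NNReal ComplexConjugate
open scoped Classical Matrix.Norms.Operator
open NumberField IsDedekindDomain MeasureTheory Measure Matrix Set Filter
open Literature.NumberTheory.Automorphic AdelicGroupData

-- the house local instances, exactly as in `RankinSelbergUnfoldingIdentity`
attribute [local instance] adelicBorel borelSpace_adelic locallyCompactSpace_adelic secondCountableTopology_gl_adelic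
  glAdeleBorel borelSpace_glAdele borelSpace_ideleGroup secondCountableTopology_ideleGroup

namespace Summit.Langlands.Langlands.Theorems.GapDecayRegimeA

section Working

variable {n m : ℕ} {K : Type} [Field K] [NumberField K]

/-- **Normalisation modulo the centre.** Every positive real diagonal `diag(a)` of `GL_n`, `n > 0`,
is `z(λ) · diag(a')` with `λ = (∏ aᵢ)^{1/n}` central, `∏ a'ᵢ = 1` and the same root ratios
`a'ᵢ/a'ⱼ = aᵢ/aⱼ`; in particular `diag(a')` lies in the Siegel cone `A_{T₀}(t)` as soon as
`aᵢ/aᵢ₊₁ ≥ t` (the computation of `IsRapidlyDecreasingGL.exists_bound_root_of_center'`). [folklore] -/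
theorem exists_posRealScalar_mul_posRealDiagonal_eq (hn : 0 < n) {t : ℝ} (a : Fin n → ℝ≥0ˣ)
    (hroot : ∀ i j : Fin n, (j : ℕ) = (i : ℕ) + 1 → t * ((a j : ℝ≥0) : ℝ) ≤ ((a i : ℝ≥0) : ℝ)) :
    ∃ (r : ℝ≥0ˣ) (a' : Fin n → ℝ≥0ˣ), (∏ k, ((a' k : ℝ≥0) : ℝ)) = 1 ∧
      (∀ i j : Fin n, (j : ℕ) = (i : ℕ) + 1 → t * ((a' j : ℝ≥0) : ℝ) ≤ ((a' i : ℝ≥0) : ℝ)) ∧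
      posRealDiagonal n K a = posRealScalar n K r * posRealDiagonal n K a' ∧
      ∀ i j : Fin n, ((a' i : ℝ≥0) : ℝ) / ((a' j : ℝ≥0) : ℝ) =
        ((a i : ℝ≥0) : ℝ) / ((a j : ℝ≥0) : ℝ) := by
  -- adapted from `IsRapidlyDecreasingGL.exists_bound_root_of_center'` (`CuspFormCornerDecay`)
  -- the central `n`-th root of `∏ aᵢ`
  set P : ℝ≥0 := ∏ k, (a k : ℝ≥0) with hP
  have hP0 : P ≠ 0 := Finset.prod_ne_zero_iff.2 fun k _ => (a k).ne_zero
  set lam : ℝ≥0 := P ^ ((n : ℝ)⁻¹) with hlam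
  have hlam0 : lam ≠ 0 := by
    rw [hlam]; exact (NNReal.rpow_pos (pos_iff_ne_zero.2 hP0)).ne'
  set r : ℝ≥0ˣ := Units.mk0 lam hlam0 with hr
  set a' : Fin n → ℝ≥0ˣ := fun k => r⁻¹ * a k with ha'
  have hlamn : lam ^ n = P := by
    rw [hlam, ← NNReal.rpow_natCast, ← NNReal.rpow_mul,
      inv_mul_cancel₀ (Nat.cast_ne_zero.2 hn.ne'), NNReal.rpow_one]
  have hprod : (∏ k, ((a' k : ℝ≥0) : ℝ)) = 1 := by
    have h1 : (∏ k, (a' k : ℝ≥0)) = 1 := by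
      simp only [ha', Units.val_mul, Finset.prod_mul_distrib, Finset.prod_const, Finset.card_univ,
        Fintype.card_fin]
      rw [Units.val_inv_eq_inv_val, inv_pow, hr, Units.val_mk0, hlamn, ← hP, inv_mul_cancel₀ hP0]
    rw [← NNReal.coe_prod, h1, NNReal.coe_one]
  have hrpos : (0 : ℝ) < ((r⁻¹ : ℝ≥0ˣ) : ℝ≥0) :=
    NNReal.coe_pos.2 (pos_iff_ne_zero.2 (r⁻¹).ne_zero)
  have ha'val : ∀ k, ((a' k : ℝ≥0) : ℝ) = ((r⁻¹ : ℝ≥0ˣ) : ℝ≥0) * ((a k : ℝ≥0) : ℝ) := fun k => by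
    rw [ha']; simp only [Units.val_mul, NNReal.coe_mul]
  refine ⟨r, a', hprod, fun i j hij => ?_, ?_, fun i j => ?_⟩
  · rw [ha'val, ha'val, mul_left_comm]
    exact mul_le_mul_of_nonneg_left (hroot i j hij) hrpos.le
  · rw [posRealScalar_mul_posRealDiagonal]
    congr 1
    funext k
    rw [ha']; simp only [mul_inv_cancel_left]
  · rw [ha'val, ha'val, mul_div_mul_left _ _ hrpos.ne']

/-- **The first chamber for translates by a compact unipotent set.** Let `Φ` be an
`A_G`-invariant rapidly decreasing function on `GL_n(𝔸_K)`, `0 < m < n`, `𝒞 ⊆ N_n(𝔸_K)` a compact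
set of upper unitriangular matrices, `Ωm ⊆ GL_m(𝔸_K)` compact, `0 < t ≤ 1` and `B > 0`. There is
`C ≥ 0` such that for all `τ > 0`, all positive real diagonal `b` in the cone `bᵢ/bᵢ₊₁ ≥ t` of
`GL_m` with `τ b_m ≥ 1`, all `y ∈ Ωm` and all `u ∈ 𝒞`,
`‖Φ(u · diag(z(τ) diag(b) y, 1_{n-m}))‖ ≤ C (τ b_m)^{-B}`: `diag(τ b, 1, …, 1) = z(λ) diag(c')`
with `diag(c') ∈ A_{T₀}(t)` (its `m`-th simple root is `τ b_m ≥ 1 ≥ t`, the others are those of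
`b` or `1 ≥ t`), `u diag(τ b, 1) ι(y) = z(λ) diag(c') · (diag(c')⁻¹ u diag(c')) ι(y)` with
`diag(c')⁻¹ u diag(c')` in a fixed compact set (Getz–Hahn Lemma 9.5.1), and Getz–Hahn's decay
(Def. 9.3) in the `m`-th simple root `τ b_m` of `c'`. The first chamber of Cogdell's "since the
cusp forms are rapidly decreasing" (§2.2, PDF p. 182), uniformly over compact unipotent left
translates. [cite: CogdellAnalyticTheory2004, §2.2 (PDF p. 182), Thm. 2.1] -/
theorem decay_regimeA (hm : 0 < m) (hmn : m < n) {Φ : GL (Fin n) (AdeleRing (𝓞 K) K) → ℂ}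
    (hZ : ∀ z ∈ (posRealScalar n K).range, ∀ g, Φ (z * g) = Φ g)
    (hrd : IsRapidlyDecreasingGL n K Φ)
    {𝒞 : Set (GL (Fin n) (AdeleRing (𝓞 K) K))} (h𝒞c : IsCompact 𝒞)
    (h𝒞U : 𝒞 ⊆ (upperUnitriangular (Fin n) (AdeleRing (𝓞 K) K) : Set (GL (Fin n) (AdeleRing (𝓞 K) K))))
    {Ωm : Set (GL (Fin m) (AdeleRing (𝓞 K) K))} (hΩm : IsCompact Ωm)
    {t : ℝ} (ht : 0 < t) (ht1 : t ≤ 1) {B : ℝ} (hB : 0 < B) :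
    ∃ C : ℝ, 0 ≤ C ∧ ∀ (τ : ℝ≥0ˣ) (b : Fin m → ℝ≥0ˣ),
      (∀ i j : Fin m, (j : ℕ) = (i : ℕ) + 1 → t * ((b j : ℝ≥0) : ℝ) ≤ ((b i : ℝ≥0) : ℝ)) →
      1 ≤ ((τ : ℝ≥0) : ℝ) * ((b ⟨m - 1, Nat.sub_lt hm one_pos⟩ : ℝ≥0) : ℝ) →
      ∀ y ∈ Ωm, ∀ u ∈ 𝒞,
        ‖Φ (u * glCorner (AdeleRing (𝓞 K) K) hmn.le (posRealScalar m K τ * posRealDiagonal m K b * y))‖ ≤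
          C * (((τ : ℝ≥0) : ℝ) * ((b ⟨m - 1, Nat.sub_lt hm one_pos⟩ : ℝ≥0) : ℝ)) ^ (-B) := by
  -- adapted from the first chamber of `exists_bound_corner_chambers` (`CuspFormCornerDecay`)
  set R := AdeleRing (𝓞 K) K with hR
  set ι : GL (Fin m) R →* GL (Fin n) R := glCorner R hmn.le with hι
  have hιc : Continuous ι := continuous_glCorner hmn.le
  have hΩn : IsCompact (ι '' Ωm) := hΩm.image hιc
  -- a compact set absorbing the conjugates `a⁻¹ u a`, `a ∈ A_{T₀}(t)`, `u ∈ 𝒞`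
  obtain ⟨C₀, hC₀c, -, hC₀⟩ := exists_isCompact_conj_siegelCone_mem ht h𝒞U h𝒞c
  have hΩ : IsCompact (C₀ * (ι '' Ωm)) := hC₀c.mul hΩn
  -- the decay constant on the compact set `C₀ · ι(Ωm)`
  obtain ⟨C₁, hC₁⟩ := hrd _ hΩ t ht B hB
  refine ⟨max C₁ 0, le_max_right _ _, fun τ b hroot hone y hy u hu => ?_⟩
  -- the corner point and its entries
  set c : Fin n → ℝ≥0ˣ := fun i => if hi : (i : ℕ) < m then τ * b ⟨i, hi⟩ else 1 with hc
  have hg : ι (posRealScalar m K τ * posRealDiagonal m K b * y) = posRealDiagonal n K c * ι y := by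
    rw [_root_.map_mul, hι, glCorner_posRealScalar_mul_posRealDiagonal]
  have hτ : (0 : ℝ) < ((τ : ℝ≥0) : ℝ) := NNReal.coe_pos.2 (pos_iff_ne_zero.2 τ.ne_zero)
  have hcval_lt : ∀ (i : Fin n) (hi : (i : ℕ) < m),
      ((c i : ℝ≥0) : ℝ) = ((τ : ℝ≥0) : ℝ) * ((b ⟨i, hi⟩ : ℝ≥0) : ℝ) := fun i hi => by
    simp only [hc, dif_pos hi, Units.val_mul, NNReal.coe_mul]
  have hcval_ge : ∀ i : Fin n, ¬ (i : ℕ) < m → ((c i : ℝ≥0) : ℝ) = 1 := fun i hi => by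
    simp only [hc, dif_neg hi, Units.val_one, NNReal.coe_one]
  -- the relevant simple root `(m - 1, m)`
  set i₁ : Fin n := ⟨m - 1, by omega⟩ with hi₁
  set j₁ : Fin n := ⟨m, hmn⟩ with hj₁
  have hij₁ : (j₁ : ℕ) = (i₁ : ℕ) + 1 := by simp only [hi₁, hj₁]; omega
  set L : ℝ := ((b ⟨m - 1, Nat.sub_lt hm one_pos⟩ : ℝ≥0) : ℝ) with hL
  have hci₁ : ((c i₁ : ℝ≥0) : ℝ) = ((τ : ℝ≥0) : ℝ) * L := by
    rw [hcval_lt i₁ (by simp only [hi₁]; omega)]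
  have hcj₁ : ((c j₁ : ℝ≥0) : ℝ) = 1 := hcval_ge j₁ (by simp only [hj₁]; omega)
  -- `c` lies in the cone `cᵢ/cᵢ₊₁ ≥ t` of `GL_n`
  have hcone : ∀ i j : Fin n, (j : ℕ) = (i : ℕ) + 1 →
      t * ((c j : ℝ≥0) : ℝ) ≤ ((c i : ℝ≥0) : ℝ) := by
    intro i j hij
    by_cases hj : (j : ℕ) < m
    · have hi : (i : ℕ) < m := by omega
      rw [hcval_lt i hi, hcval_lt j hj, mul_left_comm]
      exact mul_le_mul_of_nonneg_left (hroot ⟨i, hi⟩ ⟨j, hj⟩ (by simpa using hij)) hτ.le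
    · by_cases hi : (i : ℕ) < m
      · have him : (i : ℕ) = m - 1 := by omega
        have hbi : b ⟨i, hi⟩ = b ⟨m - 1, Nat.sub_lt hm one_pos⟩ := congrArg b (Fin.ext him)
        rw [hcval_ge j hj, hcval_lt i hi, hbi, mul_one]
        exact ht1.trans hone
      · rw [hcval_ge i hi, hcval_ge j hj, mul_one]
        exact ht1
  -- normalise modulo the centre: `diag(c) = z(λ) diag(c')`, `diag(c') ∈ A_{T₀}(t)`
  obtain ⟨lam, c', hprod, hcone', hdiag, hratio⟩ :=
    exists_posRealScalar_mul_posRealDiagonal_eq (K := K) (by omega) c hcone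
  have hmem : posRealDiagonal n K c' ∈ siegelCone n K t := ⟨c', hprod, hcone', rfl⟩
  -- the compact coordinate `(diag(c')⁻¹ u diag(c')) ι(y)`
  have hy' : (posRealDiagonal n K c')⁻¹ * u * posRealDiagonal n K c' * ι y ∈ C₀ * (ι '' Ωm) :=
    Set.mul_mem_mul (hC₀ _ hmem u hu) (Set.mem_image_of_mem _ hy)
  have hcomm : u * posRealScalar n K lam = posRealScalar n K lam * u :=
    Subgroup.mem_center_iff.1 (posRealScalar_mem_center n K lam) u
  have key : u * ι (posRealScalar m K τ * posRealDiagonal m K b * y) =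
      posRealScalar n K lam *
        (posRealDiagonal n K c' * ((posRealDiagonal n K c')⁻¹ * u * posRealDiagonal n K c' * ι y)) := by
    rw [hg, hdiag]
    simp only [← mul_assoc, mul_inv_cancel_right]
    rw [hcomm]
  have h := hC₁ c' hprod hcone' _ hy' i₁ j₁ hij₁
  rw [hratio, hci₁, hcj₁, div_one] at h
  rw [key, hZ _ ⟨lam, rfl⟩]
  calc ‖Φ (posRealDiagonal n K c' * ((posRealDiagonal n K c')⁻¹ * u * posRealDiagonal n K c' * ι y))‖
      ≤ C₁ * (((τ : ℝ≥0) : ℝ) * L) ^ (-B) := h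
    _ ≤ max C₁ 0 * (((τ : ℝ≥0) : ℝ) * L) ^ (-B) :=
        mul_le_mul_of_nonneg_right (le_max_left _ _) (Real.rpow_nonneg (by positivity) _)

end Working

/-- **E5a, registered form: the first chamber for translates by a compact unipotent set.** For an
`A_G`-invariant rapidly decreasing `Φ` on `GL_n(𝔸_K)`, `0 < m < n`, a compact set `𝒞` of upper
unitriangular matrices, a compact `Ωm ⊆ GL_m(𝔸_K)`, `0 < t ≤ 1`, `B > 0`: there is `C ≥ 0` with
`‖Φ(u · diag(z(τ) diag(b) y, 1_{n-m}))‖ ≤ C (τ b_m)^{-B}` whenever `b` is in the cone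
`bᵢ/bᵢ₊₁ ≥ t`, `τ b_m ≥ 1`, `y ∈ Ωm`, `u ∈ 𝒞` (`decay_regimeA`).
[cite: CogdellAnalyticTheory2004, §2.2 (PDF p. 182), Thm. 2.1] -/
theorem stub_decay_regimeA :
    ∀ {n m : ℕ} {K : Type} [Field K] [NumberField K] (hm : 0 < m) (hmn : m < n)
      {Φ : GL (Fin n) (AdeleRing (𝓞 K) K) → ℂ},
      (∀ z ∈ (posRealScalar n K).range, ∀ g, Φ (z * g) = Φ g) → IsRapidlyDecreasingGL n K Φ →
      ∀ {𝒞 : Set (GL (Fin n) (AdeleRing (𝓞 K) K))}, IsCompact 𝒞 →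
        𝒞 ⊆ (upperUnitriangular (Fin n) (AdeleRing (𝓞 K) K) : Set (GL (Fin n) (AdeleRing (𝓞 K) K))) →
      ∀ {Ωm : Set (GL (Fin m) (AdeleRing (𝓞 K) K))}, IsCompact Ωm →
      ∀ {t : ℝ}, 0 < t → t ≤ 1 → ∀ {B : ℝ}, 0 < B →
        ∃ C : ℝ, 0 ≤ C ∧ ∀ (τ : ℝ≥0ˣ) (b : Fin m → ℝ≥0ˣ),
          (∀ i j : Fin m, (j : ℕ) = (i : ℕ) + 1 → t * ((b j : ℝ≥0) : ℝ) ≤ ((b i : ℝ≥0) : ℝ)) →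
          1 ≤ ((τ : ℝ≥0) : ℝ) * ((b ⟨m - 1, Nat.sub_lt hm one_pos⟩ : ℝ≥0) : ℝ) →
          ∀ y ∈ Ωm, ∀ u ∈ 𝒞,
            ‖Φ (u * glCorner (AdeleRing (𝓞 K) K) hmn.le (posRealScalar m K τ * posRealDiagonal m K b * y))‖ ≤
              C * (((τ : ℝ≥0) : ℝ) * ((b ⟨m - 1, Nat.sub_lt hm one_pos⟩ : ℝ≥0) : ℝ)) ^ (-B) := by
  intro n m K _ _ hm hmn Φ hZ hrd 𝒞 h𝒞c h𝒞U Ωm hΩm t ht ht1 B hB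
  exact decay_regimeA hm hmn hZ hrd h𝒞c h𝒞U hΩm ht ht1 hB

end Summit.Langlands.Langlands.Theorems.GapDecayRegimeA

end
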